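import Mathlib
import HarnessLib
import Summits.ValiantsHypothesis.ValiantsHypothesis.Theses.MonotoneRestoration
import Literature.Computability.AlgebraicComplexity.SymmetricCircuitFibreFold

/-! # Route MonotoneRestoration — crux `MonotoneRestorationQP`, line Sketch, stub Z10
(stmt-ValiantsHypothesis-15886)

**Folding an equivariant output family along the fibres of an equivariant surjection.** If a
`Γ`-symmetric Dawar–Wilsenach labelled arithmetic circuit over the constants `K` and the
variables `X` computes a family `(g_y)_{y ∈ Y}` at outputs indexed by the finite `Γ`-set `Y`, and
`p : Y → Y'` is a `Γ`-equivariant surjection onto the finite `Γ`-set `Y'`, then the fibre sums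
`(Σ_{y : p y = y'} g_y)_{y' ∈ Y'}` and the fibre products `(Π_{y : p y = y'} g_y)_{y' ∈ Y'}` are
each computed at outputs indexed by `Y'` by a `Γ`-symmetric circuit on at most `|G| + |Y'|`
gates ("forgetting a label" in the size calculus of square-symmetric circuits).

Proof: the universe-`0` instances of the tree lemmas
`LabelledArithCircuit.IsSymmetric.exists_fibreSum` and
`LabelledArithCircuit.IsSymmetric.exists_fibreProd`
(`Literature/Computability/AlgebraicComplexity/SymmetricCircuitFibreFold.lean`): gate set
`G ⊕ Y'`, one new `+` (resp. `×`) gate `Sum.inr y'` per index over the output gates of the fibre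
`{y : p y = y'}` (nonempty by surjectivity); an automorphism `π` extending `γ` extends as
`π ⊕ (γ • ·)`, the fibre of `γ • y'` being the `γ`-translate of the fibre of `y'`.
-/

noncomputable section

-- `Summit.ValiantsHypothesis.ValiantsHypothesis.…` is the tree's mandated namespace (Sub = Summit).
set_option linter.dupNamespace false

namespace Summit.ValiantsHypothesis.ValiantsHypothesis.Theorems

open Literature.Computability.AlgebraicComplexity

/-- **Z10 — fibre sums and fibre products along an equivariant surjection** (crux
`MonotoneRestorationQP`, line Sketch; registered stub `stub_symmetric_fibreFold`): if a
`Γ`-symmetric circuit computes `(g_y)_{y ∈ Y}` and `p : Y → Y'` is a `Γ`-equivariant surjection,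
then `(Σ_{p y = y'} g_y)_{y'}` and `(Π_{p y = y'} g_y)_{y'}` are each computed at outputs indexed
by `Y'` by a `Γ`-symmetric circuit on at most `|G| + |Y'|` gates (one `+` resp. `×` gate per `y'`
over the output gates of its fibre). Instances of
`LabelledArithCircuit.IsSymmetric.exists_fibreSum` and `…exists_fibreProd`. -/
theorem stub_symmetric_fibreFold {K X Y Y' Γ G : Type} [CommSemiring K] [Group Γ]
    [MulAction Γ X] [MulAction Γ Y] [MulAction Γ Y'] [Fintype Y] [Fintype Y'] [DecidableEq Y']
    [Fintype G] (C : LabelledArithCircuit K X Y G) (hC : C.IsSymmetric Γ) (p : Y → Y')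
    (hp : ∀ (γ : Γ) (y : Y), p (γ • y) = γ • p y) (hsurj : Function.Surjective p) :
    (∃ (G' : Type) (_ : Fintype G') (C' : LabelledArithCircuit K X Y' G'),
      C'.IsSymmetric Γ ∧
      (∀ y', C'.eval (C'.output y') =
        ∑ y ∈ Finset.univ.filter (fun y => p y = y'), C.eval (C.output y)) ∧
      Fintype.card G' ≤ Fintype.card G + Fintype.card Y') ∧
    (∃ (G' : Type) (_ : Fintype G') (C' : LabelledArithCircuit K X Y' G'),
      C'.IsSymmetric Γ ∧
      (∀ y', C'.eval (C'.output y') =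
        ∏ y ∈ Finset.univ.filter (fun y => p y = y'), C.eval (C.output y)) ∧
      Fintype.card G' ≤ Fintype.card G + Fintype.card Y') :=
  ⟨hC.exists_fibreSum p hp hsurj, hC.exists_fibreProd p hp hsurj⟩

end Summit.ValiantsHypothesis.ValiantsHypothesis.Theorems

end
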